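import Summits.ResolutionOfSingularities.ResolutionOfSingularities.Theorems.EquisingularLiftEquisingularLiftCentreBlowupSpecialFibreIntegral
import HarnessLib

/-!
# `EquisingularLift`, line `Sketch` v8 — S8: blowing up an `O`-flat exceptional divisor keeps the special fibre
# irreducible (set-theoretic form)

[OURS · L1 W4.5b] Registered-by-plan stub S8 `stub_isIrreducible_specialFibre_of_isBlowup_flatCentre` of
`L/w45b/sketch-v8.lean` (plan-1, 2026-08-26) for the crux `EquisingularLift` (stmt-ResolutionOfSingularities-15660);
NOT a statement of any manuscript. It is the SET-THEORETIC sibling of stub-2's H3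
(`isIntegral_specialFibre_of_isBlowup_of_flat_exceptional`, p461776): there the scheme-theoretic special fibre
`X_κ` is assumed INTEGRAL; here only the closed SET `r⁻¹(s₀)` is assumed irreducible (the special fibre may be
non-reduced), and the conclusion is irreducibility of the set `(τ ≫ r)⁻¹(s₀)`.

Setting: `O` a discrete valuation ring (any local ring suffices for the proof) with residue field `κ` and closed
point `s₀`, `X'` a scheme over `Spec O` (`r'`), `C` an ideal sheaf on `X'`, `τ : X'' → X'` a blow-up along `C`
whose exceptional divisor `V(C · 𝒪_{X''}) → Spec O` is FLAT, the special fibre `r'⁻¹(s₀)` irreducible and not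
contained in the support of `C`. CLAIM: `(τ ≫ r')⁻¹(s₀)` is irreducible.

Proof. By flatness of the exceptional divisor, `X'' ×_{X'} X'_κ → X'_κ` is a blow-up of the scheme-theoretic
special fibre `X'_κ = X' ×_{Spec O} Spec κ` along `C · 𝒪_{X'_κ}` (`IsBlowup.pullback_snd_of_flat_exceptional`,
Stacks 0805). The underlying space of `X'_κ` is homeomorphic to `r'⁻¹(s₀)` (closed immersion), hence irreducible,
and `C · 𝒪_{X'_κ}` has support `≠ X'_κ`. A blow-up of an IRREDUCIBLE scheme along an ideal sheaf with proper
support is irreducible (`irreducibleSpace_of_isBlowup`: the preimage of the complement of the centre is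
homeomorphic to it, irreducible, and DENSE because the exceptional divisor is an effective Cartier divisor —
the tree's `IsBlowup.dense_preimage_compl`; this is `IsBlowup.irreducibleSpace` of `BlowupsIntegral.lean` with
its integrality hypothesis weakened to irreducibility, same proof). Finally `(τ ≫ r')⁻¹(s₀)` is the image of
`X'' ×_{X'} X'_κ` in `X''`.

* `irreducibleSpace_of_isBlowup` — blow-up of an irreducible scheme along a centre with non-empty complement
  is irreducible;
* `irreducibleSpace_specialFibre_of_isIrreducible` — `X_κ` is an irreducible space if `r⁻¹(s₀)` is;
* `stub_isIrreducible_specialFibre_of_isBlowup_flatCentre` — S8 as typed in `sketch-v8.lean`;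
* `isIrreducible_specialFibre_of_isBlowup_regularCentre` — H1 (p460210) + S8: the same for a regular
  `O`-flat centre of a regular locally Noetherian ambient.

References: The Stacks Project, Tags 0805, 02OS, 02ND.
-/

set_option linter.dupNamespace false -- mandated namespace `Summit.<Summit>.<Problem>` of this single-conjunct summit
set_option linter.overlappingInstances false -- the registered signature carries both [IsDomain O] and [IsDiscreteValuationRing O]

noncomputable section

open CategoryTheory CategoryTheory.Limits AlgebraicGeometry TopologicalSpace Topology
open Literature.AlgebraicGeometry.Resolution

namespace Summit.ResolutionOfSingularities.ResolutionOfSingularities.Cruxes.EquisingularLift.StrataSplit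

universe u

/-- **A blow-up of an irreducible scheme along a centre with non-empty complement is irreducible**: the open
`π⁻¹(X ∖ V(J)) ≅ X ∖ V(J)` is irreducible and dense in `X'` (the exceptional divisor is an effective Cartier
divisor). This is `IsBlowup.irreducibleSpace` (Stacks 02ND) with `IsIntegral X`, `J ≠ ⊥` weakened to
`IrreducibleSpace X`, `(X ∖ V(J)) ≠ ∅`; same proof. [cite: StacksProject, Tag 02ND] -/
theorem irreducibleSpace_of_isBlowup {X' X : Scheme.{u}} {π : X' ⟶ X} {J : X.IdealSheafData}
    [IrreducibleSpace X] (hπ : IsBlowup π J) (hJ : ((J.support : Set X)ᶜ).Nonempty) :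
    IrreducibleSpace X' := by
  -- adapted from Literature/AlgebraicGeometry/Resolution/BlowupsIntegral.lean (`IsBlowup.irreducibleSpace`)
  let V : X'.Opens := π ⁻¹ᵁ centreCompl J
  haveI : IsIso (π ∣_ centreCompl J) := hπ.isIso_compl
  -- `V` is irreducible: homeomorphic to the nonempty open `X ∖ V(J)` of the irreducible `X`
  have hUirr : IsPreirreducible ((centreCompl J : X.Opens) : Set X) :=
    (PreirreducibleSpace.isPreirreducible_univ (X := X)).open_subset (centreCompl J).2
      (Set.subset_univ _)
  haveI : PreirreducibleSpace (centreCompl J : X.Opens) := Subtype.preirreducibleSpace hUirr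
  have hVuniv : IsPreirreducible (Set.univ : Set V) := by
    have e := (asIso (π ∣_ centreCompl J)).schemeIsoToHomeo
    have : (Set.univ : Set V) = e.symm '' Set.univ := by
      rw [Set.image_univ, e.symm.range_coe]
    rw [this]
    exact (PreirreducibleSpace.isPreirreducible_univ).image _ e.symm.continuous.continuousOn
  have hVirr : IsPreirreducible (V : Set X') := by
    have : (V : Set X') = V.ι '' Set.univ := by
      rw [Set.image_univ, Scheme.Opens.range_ι]
    rw [this]
    exact hVuniv.image _ V.ι.continuous.continuousOn
  have hdense := hπ.dense_preimage_compl
  haveI : PreirreducibleSpace X' := ⟨by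
    rw [← hdense.closure_eq]
    exact hVirr.closure⟩
  obtain ⟨x, hx⟩ := hJ
  haveI : Nonempty X' := ⟨((asIso (π ∣_ centreCompl J)).inv ⟨x, hx⟩).1⟩
  exact ⟨inferInstance⟩

/-- If the set-theoretic special fibre `r⁻¹(s₀)` is irreducible, the scheme-theoretic special fibre
`X ×_{Spec O} Spec κ` (whose underlying space is homeomorphic to it along the closed immersion
`X ×_{Spec O} Spec κ → X`) is an irreducible space. [folklore] -/
theorem irreducibleSpace_specialFibre_of_isIrreducible (O : Type) [CommRing O] [IsLocalRing O]
    (X : Scheme.{0}) (r : X ⟶ Spec (.of O)) (h : IsIrreducible (r ⁻¹' {IsLocalRing.closedPoint O})) :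
    IrreducibleSpace ↥(pullback r (Spec.map (CommRingCat.ofHom (IsLocalRing.residue O)))) := by
  haveI : IsClosedImmersion (Spec.map (CommRingCat.ofHom (IsLocalRing.residue O))) :=
    IsClosedImmersion.spec_of_surjective _ IsLocalRing.residue_surjective
  have hemb : IsEmbedding (pullback.fst r (Spec.map (CommRingCat.ofHom (IsLocalRing.residue O)))) :=
    (pullback.fst r (Spec.map (CommRingCat.ofHom (IsLocalRing.residue O)))).isClosedEmbedding.toIsEmbedding
  haveI : IrreducibleSpace
      ↥(Set.range (pullback.fst r (Spec.map (CommRingCat.ofHom (IsLocalRing.residue O))))) := by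
    rw [range_fst_specialFibre]
    exact Subtype.irreducibleSpace h
  exact hemb.toHomeomorph.irreducibleSpace_iff.2 inferInstance

/-- **STUB S8 `stub_isIrreducible_specialFibre_of_isBlowup_flatCentre`** (plan-1's `L/w45b/sketch-v8.lean`,
signature verbatim). One blow-up `τ : X'' → X'` of an integral locally Noetherian `X'` over a discrete valuation
ring along a centre `C` whose exceptional divisor is `O`-FLAT keeps the (set-theoretic) special fibre
irreducible, provided the special fibre of `X'` is irreducible and not contained in the support of `C`.
[OURS · L1 W4.5b] [cite: StacksProject, Tags 0805, 02ND] -/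
theorem stub_isIrreducible_specialFibre_of_isBlowup_flatCentre : ∀ (O : Type) [CommRing O] [IsDomain O] [IsDiscreteValuationRing O] (X' X'' : AlgebraicGeometry.Scheme.{0}) [AlgebraicGeometry.IsIntegral X'] [AlgebraicGeometry.IsLocallyNoetherian X'] (r' : X' ⟶ AlgebraicGeometry.Spec (.of O)) (C : X'.IdealSheafData) (τ : X'' ⟶ X'), Literature.AlgebraicGeometry.Resolution.IsBlowup τ C → AlgebraicGeometry.Flat (CategoryTheory.CategoryStruct.comp (C.comap τ).subschemeι (CategoryTheory.CategoryStruct.comp τ r')) → ¬ (r' ⁻¹' {IsLocalRing.closedPoint O} ⊆ (C.support : Set X')) → IsIrreducible (r' ⁻¹' {IsLocalRing.closedPoint O}) → IsIrreducible ((CategoryTheory.CategoryStruct.comp τ r') ⁻¹' {IsLocalRing.closedPoint O}) := by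
  intro O _ _ _ X' X'' _ _ r' C τ hτ hflat hnot hirr
  haveI := hflat
  -- the scheme-theoretic special fibre `X'_κ` is an irreducible space
  haveI := irreducibleSpace_specialFibre_of_isIrreducible O X' r' hirr
  -- the pulled-back centre `C · 𝒪_{X'_κ}` misses a point
  have hJ : ((((C.comap (pullback.fst r' (Spec.map (CommRingCat.ofHom (IsLocalRing.residue O))))).support :
      Set ↥(pullback r' (Spec.map (CommRingCat.ofHom (IsLocalRing.residue O))))))ᶜ).Nonempty := by
    obtain ⟨x, hx, hxC⟩ := Set.not_subset.mp hnot
    obtain ⟨y, hy⟩ : x ∈ Set.range (pullback.fst r' (Spec.map (CommRingCat.ofHom (IsLocalRing.residue O)))) := by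
      rw [range_fst_specialFibre]; exact hx
    refine ⟨y, ?_⟩
    rw [Set.mem_compl_iff, Scheme.IdealSheafData.support_comap, Closeds.coe_preimage, Set.mem_preimage, hy]
    exact hxC
  -- the base change `X'' ×_{X'} X'_κ → X'_κ` is a blow-up (flat exceptional divisor), hence irreducible
  have hB : IsBlowup (pullback.snd τ (pullback.fst r' (Spec.map (CommRingCat.ofHom (IsLocalRing.residue O)))))
      (C.comap (pullback.fst r' (Spec.map (CommRingCat.ofHom (IsLocalRing.residue O))))) :=
    hτ.pullback_snd_of_flat_exceptional (IsLocalRing.ResidueField O) r'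
  haveI := irreducibleSpace_of_isBlowup hB hJ
  -- its image in `X''` is the special fibre `(τ ≫ r')⁻¹(s₀)`
  have hrange : Set.range (pullback.fst τ
      (pullback.fst r' (Spec.map (CommRingCat.ofHom (IsLocalRing.residue O))))) =
      (τ ≫ r') ⁻¹' {IsLocalRing.closedPoint O} := by
    rw [Scheme.Pullback.range_fst, range_fst_specialFibre]
    rfl
  rw [← hrange, ← Set.image_univ]
  exact (IrreducibleSpace.isIrreducible_univ _).image _ (Scheme.Hom.continuous _).continuousOn

/-- **H1 + S8.** For a regular locally Noetherian `U` over a discrete valuation ring, an ideal sheaf `K` with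
`V(K)` regular and flat over `Spec O`, and a blow-up `τ : U' → U` along `K` (the exceptional divisor is then
`O`-flat, `flat_exceptional_of_isBlowup_regularCentre`, p460210): if the special fibre of `U` is irreducible and
not contained in the centre, the special fibre of `U'` is irreducible. [folklore] -/
theorem isIrreducible_specialFibre_of_isBlowup_regularFlatCentre (O : Type) [CommRing O] [IsDomain O]
    [IsDiscreteValuationRing O] (U U' : Scheme.{0}) [IsIntegral U] [IsLocallyNoetherian U]
    (r : U ⟶ Spec (.of O)) (K : U.IdealSheafData) (hU : Scheme.IsRegular U)
    (hK : Scheme.IsRegular K.subscheme) (hflat : Flat (K.subschemeι ≫ r)) (τ : U' ⟶ U)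
    (hτ : IsBlowup τ K) (hnot : ¬ (r ⁻¹' {IsLocalRing.closedPoint O} ⊆ (K.support : Set U)))
    (hirr : IsIrreducible (r ⁻¹' {IsLocalRing.closedPoint O})) :
    IsIrreducible ((τ ≫ r) ⁻¹' {IsLocalRing.closedPoint O}) :=
  stub_isIrreducible_specialFibre_of_isBlowup_flatCentre O U U' r K τ hτ
    (flat_exceptional_of_isBlowup_regularCentre O U U' r K hU hK hflat τ hτ) hnot hirr

end Summit.ResolutionOfSingularities.ResolutionOfSingularities.Cruxes.EquisingularLift.StrataSplit

end
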